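import Literature.Probability.LatticeModels.PlaneRotatorShellDecay
import Literature.Probability.LatticeModels.PlaneRotatorStarTwoPoint
import HarnessLib

/-!
# Lieb's finite algorithm for plane rotators: box inside systems in `ℤ^ν`, and exponential decay on every
# finite volume from ONE box shell sum `S_R < 1`

E. H. Lieb, *A refinement of Simon's correlation inequality*, Comm. Math. Phys. **77** (1980) 127–135
[Lieb1980], Theorem 4 and p. 128 of the reprint ("the significance of this is that `φ(β) < 1` for some `β` implies
exponential decay ... one can, in principle, compute `β_c` to arbitrary accuracy by taking `B` to be the boundary
of a sufficiently large box"); B. Simon, Comm. Math. Phys. **77** (1980) 111, Thm 1.3 [Simon1980CMP]. The abstract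
half (inside systems with a shell, (23) for general regions from the tree theorem `liebRivasseauInequality_holds`,
Simon's iteration with a floor-distance, comparison with a reference system) is `PlaneRotatorShellDecay.lean`.
Here (`Site ν = ℤ^ν` with the tree's `ℓ^∞` norm `Site.supNorm` and boxes `box ν R = [−R, R]^ν`; `refShell`, `refCentre`):

* `boxShellSum Jf R` — for a translation-invariant ferromagnetic pair coupling `Jf` of `ℓ^∞`-range `1`,
  **Lieb's number** `S_R = ∑_{‖b‖_∞ = R} ⟨cos(θ_0 − θ_b)⟩_{[−R,R]^ν, shell free}` — ONE finite-dimensional integral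
  (over `U(1)^{(2R+1)^ν}`), Lieb's `φ(β)` for the box of radius `R`.
* `twoPoint_le_pow_boxShellSum` — on EVERY finite `Λ ⊂ ℤ^ν` (free boundary conditions),
  `⟨cos(θ_a − θ_c)⟩_Λ ≤ S_R^{⌊‖a − c‖_∞ / R⌋}`. So `S_R < 1` certifies exponential decay with rate `(−log S_R)/R`
  per unit `ℓ^∞`-distance, uniformly in the volume: `β < β_c`.
* Instances: `twoPoint_nn_le_pow_boxShellSum` (isotropic nearest-neighbour model on `ℤ^ν`, `nnBoxShellSum K ν R`)
  and `twoPoint_layered_le_pow_boxShellSum` (the layered XY model on `ℤ³`, `layeredBoxShellSum β J∥ J⊥ R`).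
  `R = 1` is the star (Theorem 4: `S_1 = 2ν·I₁(K)/I₀(K)`, tree `twoPoint_layered_le_pow_besselRatio`); `R → ∞` is
  Lieb's algorithm.

Cell use (`pub/hubbard-tc`, MO-S3, ASSUMPTIONS §1 key K5, INTERLAYER L3): the INPUT of the K5-Lieb column becomes
a certifiable number `S_R(β)` (rigorous quadrature / character expansion on the box), whose root
`S_R(J∥/T_L(R)) = 1` decreases towards `T_KT ≈ 0.89 J∥` as `R` grows, below the mean-field value `2J∥` and Lieb's
star value `1.94 J∥`; and a certified single-layer susceptibility ceiling for the layer-decoupling theorem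
(`LayeredPlaneRotatorDecoupling.lean`). Classical effective model only (K5); no `T_c` object.

Not here: the numerics of `S_R`; the infinite-volume limit; the converse ("`β < β_c ⇒ S_R < 1` for large `R`",
which needs the a-priori decay of the infinite-volume state).
-/

noncomputable section

open MeasureTheory Finset
open scoped BigOperators

namespace Literature.Probability.LatticeModels

namespace PlaneRotator

/-! ### Boxes in `ℤ^ν`: the reference box `[−R, R]^ν`, its shell, and Lieb's number `S_R` -/

section LatticeBoxes

open Literature.Barriers.CriticalPhenomena Literature.Barriers.CriticalPhenomena.LongRangeIsing

variable {ν : ℕ}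

omit ν in
/-- `‖x − y‖_∞ = ‖y − x‖_∞` (tree `Site.supNorm`). [folklore] -/
private theorem supNorm_sub_comm {ν : ℕ} (x y : Site ν) : Site.supNorm (x - y) = Site.supNorm (y - x) := by
  rw [← neg_sub, Site.supNorm_neg]

omit ν in
/-- `‖y‖_∞ ≤ ‖y‖₁`: nearest neighbours are at `ℓ^∞`-distance at most `1`. [folklore] -/
private theorem supNorm_le_l1Norm {ν : ℕ} (y : Site ν) : Site.supNorm y ≤ l1Norm y :=
  Site.supNorm_le_iff.2 fun i =>
    Finset.single_le_sum (f := fun i => (y i).natAbs) (fun _ _ => Nat.zero_le _) (Finset.mem_univ i)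

/-- The centre `0` of the reference box `box ν R = [−R, R]^ν` (tree `box`, `zero_mem_box`).
[cite: Lieb1980, p. 128 (B the boundary of a box)] -/
def refCentre (ν R : ℕ) : box ν R := ⟨0, zero_mem_box ν R⟩

/-- The **shell** `{‖b‖_∞ = R}` of the reference box, as a set of its sites — Lieb's separating set `B` = the
boundary of the box (the tree's `sphere ν R`, `mem_sphere`). [cite: Lieb1980, p. 128 (B the boundary of a box)] -/
def refShell (ν R : ℕ) : Finset (box ν R) := Finset.univ.filter fun b => Site.supNorm (b : Site ν) = R

/-- The **reference inside system**: the pair couplings `Jf` on the box `[−R, R]^ν`, shell–shell bonds removed.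
[cite: Lieb1980, eqs. (4)–(5) and p. 133 (B–B interactions part of H_C)] -/
def refCoupling (Jf : Site ν → Site ν → ℝ) (R : ℕ) (p : box ν R × box ν R) : ℝ :=
  if Site.supNorm (p.1 : Site ν) = R ∧ Site.supNorm (p.2 : Site ν) = R then 0 else Jf p.1 p.2

omit ν in
/-- The reference couplings are non-negative when `Jf` is (ferromagnetic inside Hamiltonian).
[cite: Lieb1980, eqs. (4)–(5) and p. 132 (J_{ab} ≥ 0)] -/
theorem refCoupling_nonneg {ν : ℕ} {Jf : Site ν → Site ν → ℝ} (hJf0 : ∀ x y, 0 ≤ Jf x y) (R : ℕ)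
    (p : box ν R × box ν R) : 0 ≤ refCoupling Jf R p := by
  unfold refCoupling; split_ifs <;> [exact le_rfl; exact hJf0 _ _]

variable [MeasurableSpace Circle] [BorelSpace Circle]

/-- **Lieb's number** `S_R(Jf) = ∑_{‖b‖_∞ = R} ⟨cos(θ_0 − θ_b)⟩_{[−R,R]^ν, shell free}`: the shell row sum of the
centre in the reference inside system — ONE finite-dimensional integral (over `U(1)^{(2R+1)^ν}`), Lieb's `φ(β)`
for the box of radius `R`. [cite: Lieb1980, p. 128 (φ(β) < 1 for a box ⇒ exponential decay; finite algorithm)] -/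
def boxShellSum (Jf : Site ν → Site ν → ℝ) (R : ℕ) : ℝ :=
  ∑ b ∈ refShell ν R, twoPoint (refCoupling Jf R) (refCentre ν R) b

/-- `S_R ≥ 0` (Griffiths' first inequality for the reference inside system).
[cite: Lieb1980, p. 128 (φ(β)); Ginibre1970, Example 4 (plane rotators)] -/
theorem boxShellSum_nonneg {Jf : Site ν → Site ν → ℝ} (hJf0 : ∀ x y, 0 ≤ Jf x y) (R : ℕ) :
    0 ≤ boxShellSum Jf R :=
  Finset.sum_nonneg fun b _ => twoPoint_nonneg (refCoupling_nonneg hJf0 R) _ b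

/-! ### The box criterion on every finite `Λ ⊂ ℤ^ν` -/

/-- **Lieb's box criterion (the finite algorithm), finite-volume form.** Let `Jf ≥ 0` be a translation-invariant
pair coupling on `ℤ^ν` of `ℓ^∞`-range `1` (`Jf(x,y) ≠ 0 ⇒ ‖x − y‖_∞ ≤ 1`), `R ≥ 1`, and let the model on a finite
`Λ ⊂ ℤ^ν` (free boundary conditions) have couplings `J(x,y) = Jf(x,y)`. Then for all `a, c ∈ Λ`:

  `⟨cos(θ_a − θ_c)⟩_Λ ≤ S_R^{⌊‖a − c‖_∞ / R⌋}`,  `S_R = boxShellSum Jf R`.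

Proof: (23) with the inside system `A_x = (x + [−R,R]^ν) ∩ Λ` and shell `S_x = (x + {‖·‖_∞ = R}) ∩ Λ` (range `1`:
every bond leaving the box starts on its shell); the partial box embeds into the reference box by `y ↦ y − x`, so
its shell row sum is at most `S_R` (Griffiths–Ginibre); Simon's iteration with `d = ⌊‖· − c‖_∞ / R⌋`. Hence
`S_R < 1` for ONE `R` certifies exponential decay, uniformly in `Λ`, at rate `(−log S_R)/R` per unit
`ℓ^∞`-distance — `β < β_c` ("a finite algorithm to compute the transition temperature to arbitrary accuracy").
[cite: Lieb1980, eq. (23), Theorem 4 and p. 128 (boxes); Simon1980CMP, Thm 1.3] -/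
theorem twoPoint_le_pow_boxShellSum {Jf : Site ν → Site ν → ℝ} (hJf0 : ∀ x y, 0 ≤ Jf x y)
    (hJfr : ∀ x y, Jf x y ≠ 0 → Site.supNorm (x - y) ≤ 1) (hJft : ∀ t x y, Jf (x - t) (y - t) = Jf x y)
    {R : ℕ} (hR : 1 ≤ R) (Λ : Finset (Site ν)) {J : Λ × Λ → ℝ}
    (hJ : ∀ p, J p = Jf (p.1 : Site ν) (p.2 : Site ν)) (a c : Λ) :
    twoPoint J a c ≤ boxShellSum Jf R ^ (Site.supNorm ((a : Site ν) - (c : Site ν)) / R) := by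
  classical
  have hR0 : 0 < R := hR
  have hJ0 : ∀ p, 0 ≤ J p := fun p => by rw [hJ]; exact hJf0 _ _
  -- boxes and shells inside `Λ`
  set A : Λ → Finset Λ := fun x => Finset.univ.filter fun y : Λ => Site.supNorm ((y : Site ν) - (x : Site ν)) ≤ R with hAdef
  set S : Λ → Finset Λ := fun x => Finset.univ.filter fun y : Λ => Site.supNorm ((y : Site ν) - (x : Site ν)) = R with hSdef
  have memA : ∀ x y : Λ, y ∈ A x ↔ Site.supNorm ((y : Site ν) - (x : Site ν)) ≤ R := fun x y => by simp [hAdef]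
  have memS : ∀ x y : Λ, y ∈ S x ↔ Site.supNorm ((y : Site ν) - (x : Site ν)) = R := fun x y => by simp [hSdef]
  -- bonds have `ℓ^∞`-range one
  have hbond : ∀ p : Λ × Λ, J p ≠ 0 → Site.supNorm ((p.1 : Site ν) - (p.2 : Site ν)) ≤ 1 := fun p hp => by
    rw [hJ] at hp; exact hJfr _ _ hp
  refine twoPoint_le_pow_of_shell_rowSum_le hJ0 A S (fun x y hy => ?_) (fun x => ?_) (fun x p hp => ?_)
    (s := boxShellSum Jf R) (fun x => ?_) c (d := fun y : Λ => Site.supNorm ((y : Site ν) - (c : Site ν)) / R)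
    (fun x hx hcA => ?_) (fun x b hb => ?_) a
  · -- `S x ⊆ A x`
    rw [memA]; rw [memS] at hy; exact hy.le
  · -- `x ∈ A x`
    rw [memA, sub_self]; exact (Site.supNorm_eq_zero_iff.2 rfl).le.trans (Nat.zero_le _)
  · -- every bond leaving the box starts on the shell
    have h1 := hbond p hp
    constructor
    · intro hin hout
      rw [memA] at hin; rw [memA, not_le] at hout; rw [memS]
      refine le_antisymm hin ?_
      have htri := Site.supNorm_add_le ((p.2 : Site ν) - (p.1 : Site ν)) ((p.1 : Site ν) - (x : Site ν))
      rw [sub_add_sub_cancel, supNorm_sub_comm (p.2 : Site ν) (p.1 : Site ν)] at htri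
      omega
    · intro hin hout
      rw [memA] at hin; rw [memA, not_le] at hout; rw [memS]
      refine le_antisymm hin ?_
      have htri := Site.supNorm_add_le ((p.1 : Site ν) - (p.2 : Site ν)) ((p.2 : Site ν) - (x : Site ν))
      rw [sub_add_sub_cancel] at htri
      omega
  · -- the shell row sum of the partial box is at most `S_R`
    -- the translate into the reference box
    let τ : Λ → box ν R := fun y =>
      if h : Site.supNorm ((y : Site ν) - (x : Site ν)) ≤ R then ⟨(y : Site ν) - (x : Site ν), mem_box_iff_supNorm_le.2 h⟩ else refCentre ν R
    have hτ_val : ∀ y : Λ, y ∈ A x → ((τ y : box ν R) : Site ν) = (y : Site ν) - (x : Site ν) := fun y hy => by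
      rw [memA] at hy
      simp only [τ, dif_pos hy]
    have hτx : τ x = refCentre ν R := by
      apply Subtype.ext
      rw [hτ_val x (by rw [memA, sub_self]; exact (Site.supNorm_eq_zero_iff.2 rfl).le.trans (Nat.zero_le _)), sub_self]
      rfl
    have hτinj : Set.InjOn τ (A x) := by
      intro y hy z hz hyz
      have h : ((τ y : box ν R) : Site ν) = ((τ z : box ν R) : Site ν) := congrArg _ hyz
      rw [hτ_val y hy, hτ_val z hz] at h
      exact Subtype.ext (sub_left_injective h)
    have hτS : ∀ b : Λ, b ∈ S x → τ b ∈ refShell ν R := fun b hb => by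
      have hbA : b ∈ A x := by rw [memA]; rw [memS] at hb; exact hb.le
      simp only [refShell, Finset.mem_filter, Finset.mem_univ, true_and]
      rw [hτ_val b hbA]
      exact (memS x b).1 hb
    -- domination of the inside couplings by the reference couplings
    have hdom : ∀ y ∈ A x, ∀ z ∈ A x,
        insideCoupling J (A x) (S x) (y, z) ≤ refCoupling Jf R (τ y, τ z) := by
      intro y hy z hz
      by_cases hS : y ∈ S x ∧ z ∈ S x
      · rw [insideCoupling_of_shell (A := A x) hS.1 hS.2]
        exact refCoupling_nonneg hJf0 R _
      · rw [insideCoupling_of_mem (p := (y, z)) hy hz hS, hJ]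
        unfold refCoupling
        rw [if_neg, hτ_val y hy, hτ_val z hz, hJft]
        simp only [hτ_val y hy, hτ_val z hz, ← memS]
        exact hS
    calc ∑ b ∈ S x, twoPoint (insideCoupling J (A x) (S x)) x b
        ≤ ∑ b ∈ S x, twoPoint (refCoupling Jf R) (refCentre ν R) (τ b) := by
          refine Finset.sum_le_sum fun b hb => ?_
          have hbA : b ∈ A x := by rw [memA]; rw [memS] at hb; exact hb.le
          have hxA : x ∈ A x := by rw [memA, sub_self]; exact (Site.supNorm_eq_zero_iff.2 rfl).le.trans (Nat.zero_le _)
          have h := twoPoint_le_of_injOn (insideCoupling_nonneg hJ0 (A x) (S x))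
            (insideCoupling_support J (A x) (S x)) τ hτinj (refCoupling_nonneg hJf0 R) hdom hxA hbA
          rwa [hτx] at h
      _ = ∑ b' ∈ (S x).image τ, twoPoint (refCoupling Jf R) (refCentre ν R) b' := by
          rw [Finset.sum_image]
          intro y hy z hz hyz
          exact hτinj ((memA x y).2 ((memS x y).1 hy).le) ((memA x z).2 ((memS x z).1 hz).le) hyz
      _ ≤ boxShellSum Jf R := by
          refine Finset.sum_le_sum_of_subset_of_nonneg (fun b' hb' => ?_)
            fun b' _ _ => twoPoint_nonneg (refCoupling_nonneg hJf0 R) _ _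
          obtain ⟨b, hb, rfl⟩ := Finset.mem_image.1 hb'
          exact hτS b hb
  · -- `d x ≠ 0` forces `c` out of the interior of the box of `x`
    rw [memS]; rw [memA] at hcA
    have hge : R ≤ Site.supNorm ((x : Site ν) - (c : Site ν)) := by
      by_contra hlt
      exact hx ((Nat.div_eq_zero_iff_lt hR0).2 (not_le.1 hlt))
    rw [supNorm_sub_comm] at hge
    exact le_antisymm hcA hge
  · -- `d` drops by at most one across a shell: `‖x − c‖_∞ ≤ R + ‖b − c‖_∞`
    rw [memS] at hb
    have htri := Site.supNorm_add_le ((x : Site ν) - (b : Site ν)) ((b : Site ν) - (c : Site ν))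
    rw [sub_add_sub_cancel, supNorm_sub_comm (x : Site ν) (b : Site ν), hb] at htri
    calc Site.supNorm ((x : Site ν) - (c : Site ν)) / R ≤ (Site.supNorm ((b : Site ν) - (c : Site ν)) + R) / R :=
          Nat.div_le_div_right (by omega)
      _ = Site.supNorm ((b : Site ν) - (c : Site ν)) / R + 1 := Nat.add_div_right _ hR0

/-! ### Instances: the nearest-neighbour model on `ℤ^ν` and the layered XY model on `ℤ³` -/

/-- Lieb's number for the **isotropic nearest-neighbour XY model on `ℤ^ν`** at dimensionless coupling `K = βJ`:
`S_R(K) = ∑_{‖b‖_∞ = R} ⟨cos(θ_0 − θ_b)⟩_{[−R,R]^ν, K, shell free}` (`R = 1`: `2ν·I₁(K)/I₀(K)`, Theorem 4).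
[cite: Lieb1980, Theorem 4 and p. 128 (boxes)] -/
def nnBoxShellSum (K : ℝ) (ν R : ℕ) : ℝ :=
  boxShellSum (fun x y : Site ν => K / 2 * nnCoupling ν x y) R

/-- **Lieb's box criterion for the nearest-neighbour XY model on `ℤ^ν`.** For `K ≥ 0`, `R ≥ 1`, every finite
`Λ ⊂ ℤ^ν` (free boundary conditions) and `a, c ∈ Λ`:
`⟨cos(θ_a − θ_c)⟩_{Λ,K} ≤ S_R(K)^{⌊‖a − c‖_∞ / R⌋}`. So `S_R(K) < 1` for one box radius `R` certifies `K < K_c`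
(`ν = 2`: `T > T_KT`), the bound improving to the critical point as `R → ∞`.
[cite: Lieb1980, Theorem 4 and p. 128 (boxes; finite algorithm); Simon1980CMP, Thm 1.3] -/
theorem twoPoint_nn_le_pow_boxShellSum {K : ℝ} (hK : 0 ≤ K) {R : ℕ} (hR : 1 ≤ R) (Λ : Finset (Site ν))
    (a c : Λ) :
    twoPoint (nnXYCoupling K ν Λ) a c ≤ nnBoxShellSum K ν R ^ (Site.supNorm ((a : Site ν) - (c : Site ν)) / R) := by
  refine twoPoint_le_pow_boxShellSum (Jf := fun x y : Site ν => K / 2 * nnCoupling ν x y)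
    (fun x y => mul_nonneg (by positivity) (nnCoupling_nonneg _ _)) (fun x y hxy => ?_) (fun t x y => ?_) hR Λ
    (fun p => rfl) a c
  · have h1 : l1Norm (x - y) = 1 := by
      by_contra h
      exact hxy (by unfold nnCoupling; rw [if_neg h, mul_zero])
    exact (supNorm_le_l1Norm _).trans h1.le
  · simp only [nnCoupling, sub_sub_sub_cancel_right]

/-- Lieb's number for the **layered XY model on `ℤ³`** (in-plane `J∥`, inter-layer `J⊥`, inverse temperature `β`):
`S_R(β; J∥, J⊥) = ∑_{‖b‖_∞ = R} ⟨cos(θ_0 − θ_b)⟩_{[−R,R]³, shell free}`; at `J⊥ = 0` the box decouples into layers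
and this is the two-dimensional number `S_R(βJ∥)`. [cite: Lieb1980, Theorem 4 and p. 128 (boxes); LiuStanley1972, p. 272 (layers (J, J, εJ))] -/
def layeredBoxShellSum (β Jp Jz : ℝ) (R : ℕ) : ℝ :=
  boxShellSum (fun x y : Site 3 => β / 2 * layeredCoupling Jp Jz x y) R

omit ν in
/-- **Lieb's box criterion for the layered XY model on `ℤ³`** (cell `pub/hubbard-tc`, K5-Lieb column with boxes):
for `β, J∥, J⊥ ≥ 0`, `R ≥ 1`, every finite `Λ ⊂ ℤ³` and `a, c ∈ Λ`,
`⟨cos(θ_a − θ_c)⟩_{Λ,β} ≤ S_R(β; J∥, J⊥)^{⌊‖a − c‖_∞ / R⌋}`. Hence `k_B T_c^{XY}(J∥, J⊥) ≤ T` as soon as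
`S_R(1/T; J∥, J⊥) < 1` for some `R` — Lieb's finite algorithm, whose `R = 1` step is the star bound
`4u(βJ∥) + 2u(βJ⊥) < 1` of `PlaneRotatorLiebCriterion.lean`. Classical effective model only (K5).
[cite: Lieb1980, Theorem 4 and p. 128 (boxes; finite algorithm); Simon1980CMP, Thm 1.3] -/
theorem twoPoint_layered_le_pow_boxShellSum {β Jp Jz : ℝ} (hβ : 0 ≤ β) (hp : 0 ≤ Jp) (hz : 0 ≤ Jz) {R : ℕ}
    (hR : 1 ≤ R) (Λ : Finset (Site 3)) (a c : Λ) :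
    twoPoint (layeredXYCoupling β Jp Jz Λ) a c ≤
      layeredBoxShellSum β Jp Jz R ^ (Site.supNorm ((a : Site 3) - (c : Site 3)) / R) := by
  refine twoPoint_le_pow_boxShellSum (Jf := fun x y : Site 3 => β / 2 * layeredCoupling Jp Jz x y)
    (fun x y => mul_nonneg (by positivity) (layeredCoupling_nonneg hp hz _ _)) (fun x y hxy => ?_)
    (fun t x y => ?_) hR Λ (fun p => rfl) a c
  · have h1 : l1Norm (x - y) = 1 := by
      by_contra h
      exact hxy (by unfold layeredCoupling; rw [if_neg h, mul_zero])
    exact (supNorm_le_l1Norm _).trans h1.le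
  · simp only [sub_eq_add_neg, layeredCoupling_add]

end LatticeBoxes

/-! ### `R = 1`: the box of radius one is Lieb's star — `S_1` is the row of two-spin values (Theorem 4) -/

section RadiusOne

open Literature.Barriers.CriticalPhenomena Literature.Barriers.CriticalPhenomena.LongRangeIsing

variable {ν : ℕ}

omit ν in
/-- In the box of radius `1` the shell `{‖b‖_∞ = 1}` is everything but the centre. [folklore] -/
private theorem supNorm_eq_one_iff_ne_centre {ν : ℕ} (b : box ν 1) :
    Site.supNorm (b : Site ν) = 1 ↔ b ≠ refCentre ν 1 := by
  have hb : Site.supNorm (b : Site ν) ≤ 1 := mem_box_iff_supNorm_le.1 b.2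
  constructor
  · intro h hbc
    rw [hbc] at h
    exact absurd ((Site.supNorm_eq_zero_iff.2 rfl).symm.trans h) zero_ne_one
  · intro hne
    have h0 : Site.supNorm (b : Site ν) ≠ 0 := fun h0 =>
      hne (Subtype.ext (Site.supNorm_eq_zero_iff.1 h0))
    omega

/-- **`R = 1` is the star.** The reference inside system of the box of radius one (shell–shell bonds removed) is
exactly the STAR of the centre in the sense of `PlaneRotator.starCoupling`: only the bonds with the centre as an
endpoint survive ("It is immaterial whether the `B` spins are connected together"). [cite: Lieb1980, proof of Theorem 4 (star graph; B–B interactions part of H_C)] -/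
theorem refCoupling_one_eq_starCoupling (Jf : Site ν → Site ν → ℝ) :
    refCoupling Jf 1 = starCoupling (fun p : box ν 1 × box ν 1 => Jf p.1 p.2) (refCentre ν 1) := by
  funext p
  by_cases h : p.1 = refCentre ν 1 ∨ p.2 = refCentre ν 1
  · have hn : ¬(Site.supNorm (p.1 : Site ν) = 1 ∧ Site.supNorm (p.2 : Site ν) = 1) := by
      rw [supNorm_eq_one_iff_ne_centre, supNorm_eq_one_iff_ne_centre]; tauto
    rw [show starCoupling (fun p : box ν 1 × box ν 1 => Jf p.1 p.2) (refCentre ν 1) p = Jf p.1 p.2 from if_pos h]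
    exact if_neg hn
  · have hy : Site.supNorm (p.1 : Site ν) = 1 ∧ Site.supNorm (p.2 : Site ν) = 1 := by
      rw [supNorm_eq_one_iff_ne_centre, supNorm_eq_one_iff_ne_centre]; tauto
    rw [show starCoupling (fun p : box ν 1 × box ν 1 => Jf p.1 p.2) (refCentre ν 1) p = 0 from if_neg h]
    exact if_pos hy

variable [MeasurableSpace Circle] [BorelSpace Circle]

/-- **Lieb's number at `R = 1` is the row of two-spin values**: `S_1(Jf) = ∑_{‖b‖_∞ = 1} I₁(K_b)/I₀(K_b)`,
`K_b = Jf(0,b) + Jf(b,0)` (tree `twoPoint_starCoupling_eq`: the star two-point function is the two-spin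
expectation). For the nearest-neighbour model (`K_b = K` on the `2ν` neighbours, `0` at the other shell sites,
`I₁(0)/I₀(0) = 0`) this is Theorem 4's `2ν·I₁(K)/I₀(K)`; for the layered model `4u(βJ∥) + 2u(βJ⊥)`
(`twoPoint_layered_le_pow_besselRatio`). [cite: Lieb1980, Theorem 4 (⟨σ_a·σ_b⟩ for the two-spin system = I₁(β)/I₀(β))] -/
theorem boxShellSum_one (Jf : Site ν → Site ν → ℝ) :
    boxShellSum Jf 1 = ∑ b ∈ refShell ν 1,
      besselI 1 (Jf 0 b + Jf b 0) / besselI 0 (Jf 0 b + Jf b 0) := by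
  classical
  unfold boxShellSum
  refine Finset.sum_congr rfl fun b hb => ?_
  have hb1 : Site.supNorm (b : Site ν) = 1 := (Finset.mem_filter.1 hb).2
  have hcb : refCentre ν 1 ≠ b := fun h => ((supNorm_eq_one_iff_ne_centre b).1 hb1) h.symm
  rw [refCoupling_one_eq_starCoupling, twoPoint_starCoupling_eq _ hcb]
  rfl

end RadiusOne

end PlaneRotator

end Literature.Probability.LatticeModels

end
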